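import Summits.HodgeConjecture.HodgeConjecture.Theorems.F0P3cStCharTSSaHeadTorus10    -- ★ (S-a) head: brings the organ's whole vocabulary (`Gqs`, `HLengthTwoLabels`, `xiLocalChar`, `finExplicitCollection`, `torusChart`, `vanDijkWeight`, …)
import Summits.HodgeConjecture.HodgeConjecture.Theorems.F0P3cStCharTSCartanFields      -- ★ p851300 (LH6-p01) S9a: (C1)(C3); (C2) mod CARTAN-NULL (brings ★ EllField S2)
import Summits.HodgeConjecture.HodgeConjecture.Theorems.F0P3cStCharTSLdsOpp           -- ★ p851264 (LH6-p05) S8b: `ldsCharactersOpposite_of_PS3`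
import Summits.HodgeConjecture.HodgeConjecture.Theorems.F0P3cStCharTSEllOpen           -- ★ p851296 (F0P2-p06) S8a: `isOpen_setOf_isRegularElt_and_not_mem_hyperbolicSet`
import Summits.HodgeConjecture.HodgeConjecture.Theorems.F0P3cStCharTSXiDict            -- ★ p851282 (LH6-p03) S6b (+ ★ p851228 KeysFields, LH6-p04): `keysFields_sockets`
import Summits.HodgeConjecture.HodgeConjecture.Theorems.F0P3cStCharTSL2dOfHcb          -- ★ p851304 (LH6-p02) S9c: `l2dEll_of_hcBounded`
import Summits.HodgeConjecture.HodgeConjecture.Theorems.F0P3cStCharTSParField          -- ★ p851306 (LH6-p03) S7 part 1: `parField_sockets`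
import Summits.HodgeConjecture.HodgeConjecture.Theorems.F0P3cStCharTSCartanNull        -- ★ p851303 (F0P3-p04) S9b′: `cartanNull_of_rootKernels`
import Summits.HodgeConjecture.HodgeConjecture.Theorems.F0P3cStCharTSLdsFields         -- ★ p851311 (LH6-p05) S5: `lds_sockets_of_ldsFields`
import Summits.HodgeConjecture.HodgeConjecture.Theorems.F0P3cStCharTSDefHGlue         -- ★ p851385 (LH4-p02) S12a: `defH_of_hcBoundedH`
import Summits.HodgeConjecture.HodgeConjecture.Theorems.F0P3cStCharTSPs3Lds          -- ★ (LH6-p02 g5) PS3-LDS: `ps3_of_ldsFields`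
import Summits.HodgeConjecture.HodgeConjecture.Theorems.F0P3cStCharTSU2OfUpDom       -- ★ (F0P3-p02) S13a: `l2UpOnTorus_of_upDom_LB` (DEAL #4 `_LB` twin, LH3-p03), `hcbUp_of_upDom`
import Summits.HodgeConjecture.HodgeConjecture.Theorems.F0P3cStCharTSGermThree      -- ★ (LH4-p03) S11: `germThree_local_of_germResidue`
import Summits.HodgeConjecture.HodgeConjecture.Theorems.F0P3cStCharTSPs2Assembly    -- ★ (LH6-p03) S7-2: `ps2_of_kinds`
import Summits.HodgeConjecture.HodgeConjecture.Theorems.F0P3cStCharTSUpDom          -- ★ (LH4-p01) S13c: `upDom_of_upDef`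
import Summits.HodgeConjecture.HodgeConjecture.Theorems.F0P3cStCharTSPsVanish       -- ★ (LH6-p04) PS-VANISH (V2): `char_eq_zero_on_ellG_of_isConstituentOf_irreducible`
import Summits.HodgeConjecture.HodgeConjecture.Theorems.F0P3cStCharTSEllClass       -- ★ (LH6-p03) ELL-CLASS: `ellipticClassification_of_redJH`
import Summits.HodgeConjecture.HodgeConjecture.Theorems.F0P3cStCharTSDGField        -- ★ p851395 (LH4-p02) DG-FIELD: `measurable_DG`, `DG_eq_zero_or_le`, `DG_coe_torus_eq_of_unit_rel` from the closed formula
import Summits.HodgeConjecture.HodgeConjecture.Theorems.F0P3cStCharTSDGFieldTwo     -- ★ p851405 (F0P3-p02) DG-FIELD-TWO: `continuous_dgFormulaTwo`, the two letters of the rank-2 closed formula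
import Summits.HodgeConjecture.HodgeConjecture.Theorems.F0P3cStCharTSDGLc           -- ★ (F0P3-p02) DG-LC: `DG_eventually_eq_of_mem_regG`
import Summits.HodgeConjecture.HodgeConjecture.Theorems.F0P3cStCharTSDHStable       -- ★ p851560 (LH4-p01) DH-STABLE: `hDHst_of_pin`
import Summits.HodgeConjecture.HodgeConjecture.Theorems.F0P3cStCharTSDHLc           -- ★ p851612 (F0P3-p02) DH-LC: `hDHlc_of_pin`
import Summits.HodgeConjecture.HodgeConjecture.Theorems.F0P3cStCharTSPs2Kind2Datum  -- ★ p851578 (LH6-p02) PS2-KIND2-DATUM: `ps2_kind2_of_fields` (the kind-2 trace identity `hK2` from `hSt`)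
import Summits.HodgeConjecture.HodgeConjecture.Theorems.F0P3cStCharTSUniqPar        -- ★ p851567 (LH6-p02) UNIQ-PAR: `uniqPar_of_fields` ((UNIQ-PAR) from Keys' list `hKeysRed`)
import Summits.HodgeConjecture.HodgeConjecture.Theorems.F0P3cStCharTSRedJH          -- ★ p851585∕RED-JH (LH6-p04) «RED-JH ⟸ KEYS-RED»: `ellipticClassification_of_keysRed` (brings ★ ELL-CLASS)
import Summits.HodgeConjecture.HodgeConjecture.Theorems.F0P3cStCharTSUprLi          -- ★ (F0P3-p02 g21) UPR-LI: `upRegularity_of_upDef` ((UPR) from (UP-DEF) modulo (HC-D) `hDGli`)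
import Summits.HodgeConjecture.HodgeConjecture.Theorems.F0P3cStCharTSUpTrSpecLB      -- ★ p852447 (F0P3-p02 g23) UP-TR PLUG: `upSpecLB_of_upTransferLB` (brings ★ UP-MEAS∀ p851766, ★ UP-CLASS, ★ def `Ch12Sec5.EllipticData.UpSpecLB` p852414)
import Summits.HodgeConjecture.HodgeConjecture.Theorems.F0P3cStCharTSUpTrDatumDict    -- ★ p852436 (F0P3-p02 g23) (P1) UP-TR DICTIONARY: `upTransferLB_of_concrete` (the concrete (A1′) display ↦ the `hUpTrLB` letter by the pins)
import Summits.HodgeConjecture.HodgeConjecture.Theorems.F0P3cStCharTSUpTrAssembly      -- ★ (A1′) FILE F (LH10-p01 g8) ROAD «UP-TR» terminus: `upTransferLB_concrete` (the p. 183 display, locally-bounded reading, on the organ's concrete data)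
import Summits.HodgeConjecture.HodgeConjecture.Theorems.F0P3cStCharTSDGFieldReg       -- ★ (LH4-p02) DG-FIELD-REG: `DG_conj` (D_G a class function, from the closed formula)
import Summits.HodgeConjecture.HodgeConjecture.Theorems.F0P3cStCharTSWeylDatumPinsWIF  -- ★ (LH5-p02 g7) WIF-AT-THE-DATUM by pins: `weylIntegrationFormula_of_datumPins` (M-socket ★ JAC-LOC inside; compact-torus socket `hJacT`)
import Summits.HodgeConjecture.HodgeConjecture.Theorems.F0P3cStCharTSCartanReps           -- ★ `exists_isRegularElt_centralizer_eq_cmTorus` (`M = Z(m₀)`, m₀ regular)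
import Summits.HodgeConjecture.HodgeConjecture.Theorems.F0P3cStCharTSJacCartanTerminus   -- ★ p852343 (LH5-p02 g7) JAC-ELL C8 terminus: `tubeJacobianSocket_compactCartan` (the compact-Cartan tube-Jacobian socket, IN HOUSE)
import Summits.HodgeConjecture.HodgeConjecture.Theorems.F0P3cStCharTSProp1261aOfNorms   -- ★ p852737 (F0P3a-p09 g12) «61A-OF-NORMS★» `prop1261a_of_norms` (K2′ ⟹ Prop. 12.6.1 (a))
import Summits.HodgeConjecture.HodgeConjecture.Theorems.F0P3cStCharTSOpp23             -- ★ p852725 (F0P2-p02 g23) «OPP-23★» `charOpposite_of_PS2`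
import Summits.HodgeConjecture.HodgeConjecture.Theorems.F0P3cStCharTSProp1261cOfNorms   -- ★ p852727 (F0P2-p02 g23) «61C-OF-NORMS★» `prop1261c_of_prop1261a` (K4′ ⟹ Prop. 12.6.1 (c))
import Summits.HodgeConjecture.HodgeConjecture.Theorems.F0P3cStCharTSEllOut            -- ★ (LH6-p03 g4) «ELL-OUT★» `ellipticOfL2_of_PL`
import Summits.HodgeConjecture.HodgeConjecture.Theorems.F0P3cStCharTSEonpsOut          -- ★ (F0P3a-p05 g25) «EONPS-OUT★» `ellipticOfNotPrincipalSeries_of_prop1261c_of_PL` («elliptic ⟸ not PS» from Prop. 12.6.1 (c) + the §12.2 list)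
import Literature.NumberTheory.Rogawski1990.SupercuspidalNotSphericalCofinite               -- ★ `IrrClass.isSquareIntegrable_of_isSupercuspidal_of_isCompact_center` ((SC-L2))
import Summits.HodgeConjecture.HodgeConjecture.Theorems.F0P3cStCharTSScPseudoCoeff     -- ★ p852902 (F0P3a-p02 g26) E2-5b «HC-SC» terminus: (N1) `innerG_char_self_eq_one_of_isSupercuspidal`, (N0) `innerG_char_eq_zero_of_ne_of_isSupercuspidal`, (P) `exists_isPseudoCoeff_of_isSupercuspidal`
import Summits.HodgeConjecture.HodgeConjecture.Theorems.F0P3cStCharTSScFin             -- ★ `innerG_conj_symm` (Hermitian symmetry of `⟨·,·⟩_{G,e}`)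
import Summits.HodgeConjecture.HodgeConjecture.Theorems.F0P3cStCharTSL2dEll            -- ★ (LH6-p02 g4) «L2D-ELL★» `l2CharOnTorusAll_of_elliptic`
import Summits.HodgeConjecture.HodgeConjecture.Theorems.F0P3cStCharTSEPGlueGNotWild          -- ★ p853093 (F0P3a-p09) `exists_epFunction_G_of_not_wild` (v unramified OR v ∤ 2); brings
--   ★ Summits.HodgeConjecture.HodgeConjecture.Theorems.F0P3cStCharTSEPGlueG                 -- ★ p853021 (LH10-p02 g12) (G3) «EP-GLUE-G»: `exists_epFunction_G` (Kottwitz's Euler–Poincaré function on `U(Φ₃)(L⁺_v)`, v UNRAMIFIED)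
import Summits.HodgeConjecture.HodgeConjecture.Theorems.F0P3cStCharTSEllMassG                -- ★ p852975∕p853003 (F0P3b-p01) (G4) «ELL-MASS-G»: `ellipticWeylMass_G_eq_one_of_epFunction_of_l2CharOnTorusAll`
import Summits.HodgeConjecture.HodgeConjecture.Theorems.F0P3cStCharTSEPPseudoCoeffStLetters  -- ★ p853007 (F0P3-p02 g25) (G5) «DET-CHAR + PC-ST»: `exists_isPseudoCoeff_detG_of_epFunction`, `exists_isPseudoCoeff_stG_of_epFunction`, `innerG_char_stG_self_eq_one_of_mass`
import Literature.NumberTheory.Rogawski1990.Ch12Sec7CharacterInputs                     -- ★ the named fact `normalizedCharacter_locallyBounded`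
import HarnessLib

/-!
# F0 · P3c · line LH6 «StCharTS» — «DATUM-JUNCTION v12» («EP-SPLIT, NOT-WILD», RIDER 2a′): the BODY of the (S-𝔇) organ `stub_EllipticPackage` for a GIVEN datum `𝔇 d T par μ_v` FROM the datum-road pins

Cell `pub/hodgecm-mathlib`, crux H413 = `stmt-HodgeConjecture-24833` (lane `--supports … --as helper`); seat LH6-p01 (g6) (junction–rung-0 ∕ rider pen).  THEOREMS ONLY; ★-only imports.
WHAT.  `ellipticPackage_body_of_inputs₁₂`: the 62 HYPOTHESES (= ★ J11 p853071's with #49 `hPCEnsEP ↦ hPCEnsNW`, #51 `hL2oneNsEP ↦ hL2oneNsNW` — the K1 ∕ K2′ letters now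
exclude, AT EVERY NON-WILD PLACE (`v` unramified in `L` OR `v ∤ 2`), the EP-family instances `St_G(ψ)`, `ψ∘det_G` via the guard `¬ ((Algebra.IsUnramifiedIn (𝓞 L) v.asIdeal ∨ Valued.v (2 : v.adicCompletion ↥(maximalRealSubfield L)) = 1) ∧ ∃ ψ, Continuous ψ ∧ (π = 𝔇.stG ψ ∨ π = 𝔇.detG ψ))`
(resp. `σ = 𝔇.stG ψ`) — plus ONE NEW LAST letter #62 `eSt` = the rung-0 ST-PIN EXTRA (`ιZ`, `detZ`, `𝔇.detG ψ = [ψ ∘ det_G]`, JH constituents, L² flags)) IMPLY the 47-conjunct body,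
BYTE-IDENTICAL to ★ J8∕J9∕J10's conclusion.  Inside: the EP instances are REBUILT by ★ (G5) `exists_isPseudoCoeff_detG_of_epFunction` ∕ `exists_isPseudoCoeff_stG_of_epFunction` ∕
`innerG_char_stG_self_eq_one_of_mass` (F0P3-p02 (g25), p853007) over ★ `exists_epFunction_G_of_not_wild` (F0P3a-p09, p853093; ★ (G3) p853021 + the tame-ramified twin), ★ (G4)
`ellipticWeylMass_G_eq_one_of_epFunction_of_l2CharOnTorusAll` (F0P3b-p01, p852975∕p853003) and ★ OPP-23 at the pair `(detG ψ, stG ψ)`; the supercuspidal instances by ★ E2 (as v10); then v9's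
NORMS∕EONPS derivations and v8's UP line.  Census of every other letter: ★ J7 p852368 … ★ J10 p852955 docstrings.  LEAD T15-11∕T15-13∕T15-17; G-row dealer F0P3a-p09 (g13).
HONEST LABEL: K1∕K2′ shrink to «non-supercuspidal AND (wild v OR outside the EP family)»; VERSION 12 supersedes v11 ★ p853071 (one token: the place condition) — printed inputs shrunk, not removed; at a WILD place (v | 2 ramified) nothing moves (WILD open);
organs 2 = 2, count-neutral; T14-26 (β)'s UP caveat stands; HC_CM is proved only modulo the 7 printed citations (2 remaining: hLiu418 = `stmt-HodgeConjecture-24832`, h413 = `stmt-HodgeConjecture-24833`) until rung 0 closes.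

## References
* [Rogawski1990] J. D. Rogawski, *Automorphic Representations of Unitary Groups in Three Variables*, Ann. of Math. Stud. 123 (1990): §12.5 pp. 182–187; §12.6 pp. 187–189; Lemma 12.7.2 (proof) pp. 191–194; §12.2 pp. 172–174.
* [Keys1984] D. Keys, *Principal series representations of special unitary groups over local fields*, Compositio Math. 51 (1984), §7.
* [HarishChandra1970] Harish-Chandra (notes by G. van Dijk), *Harmonic Analysis on Reductive p-adic Groups*, LNM 162 (1970): Part VII §1, Theorem 15.
-/

set_option autoImplicit false
-- the mandated namespace has the single-problem summit's repeated segment (`HodgeConjecture.HodgeConjecture`)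
set_option linter.dupNamespace false

noncomputable section

open NumberField IsDedekindDomain MeasureTheory Filter Topology
open scoped Matrix MatrixGroups NNReal ENNReal
open Literature.MeasureTheory.Group
open Literature.NumberTheory.Rogawski1990 Literature.NumberTheory.Automorphic Literature.NumberTheory.Automorphic.UnitaryGroup
open Literature.NumberTheory.Automorphic.UnitaryGroup.CotangentForms Literature.NumberTheory.GaloisRepresentations
open Literature.NumberTheory.Automorphic.Arthur2013.Leaves.TECR
open Summit.HodgeConjecture.HodgeConjecture.Cruxes.H413.F0P3cStCharTSTorusDefs

namespace Summit.HodgeConjecture.HodgeConjecture.Cruxes.H413.F0P3cStCharTSDatumJunction12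

open scoped Classical in
set_option maxHeartbeats 1600000 in
-- the statement is the (S-𝔇) organ's text (ED. 17), whose elaboration budget this matches
/-- **«DATUM-JUNCTION v11»: the body of (S-𝔇) from the slices' field equations and the named inputs.**  See the module docstring for the hypothesis census;
derived inside: (E⊆R) (C1) (C2) (C3) (T3) (SPLIT-NOT-ELL) (PIN) (PI2-L2) `LdsCharactersOpposite` (L2D-ell) (PS1) (NONL2-PAR) (LDS) (LDS2) (DEF-H) (PS3) (U2) (HCB-up) `UpSpecLB` (GERM-3) (PS2) `EllipticClassification` (UP-DOM) (UPR) (UNIQ-PAR) RED-JH DH-STABLE∕DH-LC DG-FIELD∕DG-LC (kind-2 trace identity) — everything else is passed through verbatim.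
[cite: Rogawski1990, §12.5 pp. 182–187; §12.6 pp. 187–189; Lemma 12.7.2 (proof) pp. 191–194] -/

theorem ellipticPackage_body_of_inputs₁₂ :
  ∀ (L : Type) [Field L] [NumberField L] [IsCMField L] (μ : HeckeCharacter L) (ξ : OneDimAutRepH L) (v : HeightOneSpectrum (𝓞 ↥(maximalRealSubfield L))),
    (∀ w : PlacesOver L v, IsCMField.complexConj L • w.1 = w.1) → μ.IsUnitary →
    (∀ x : Literature.NumberTheory.GaloisRepresentations.ideleGroup ↥(maximalRealSubfield L),
      μ (AdeleRing.ideleBaseChange (↥(maximalRealSubfield L)) L x) = quadraticHeckeCharCM L x) →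
    ∀ [MeasurableSpace (((UnitaryGroup.cmDatum L 2 (Matrix.of fun i j : Fin 2 => if i.val + j.val + 1 = 2 then (1 : L) else 0)).Local v × (UnitaryGroup.cmDatum L 1 (Matrix.of fun i j : Fin 1 => if i.val + j.val + 1 = 1 then (1 : L) else 0)).Local v))] [BorelSpace (((UnitaryGroup.cmDatum L 2 (Matrix.of fun i j : Fin 2 => if i.val + j.val + 1 = 2 then (1 : L) else 0)).Local v × (UnitaryGroup.cmDatum L 1 (Matrix.of fun i j : Fin 1 => if i.val + j.val + 1 = 1 then (1 : L) else 0)).Local v))] [MeasurableSpace (Gqs L v)] [BorelSpace (Gqs L v)]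
      (νHv : Measure (((UnitaryGroup.cmDatum L 2 (Matrix.of fun i j : Fin 2 => if i.val + j.val + 1 = 2 then (1 : L) else 0)).Local v × (UnitaryGroup.cmDatum L 1 (Matrix.of fun i j : Fin 1 => if i.val + j.val + 1 = 1 then (1 : L) else 0)).Local v))) (νQv : Measure (Gqs L v))
      [νHv.IsHaarMeasure] [νHv.IsMulRightInvariant] [νQv.IsHaarMeasure] [νQv.IsMulRightInvariant],
    letI : ∀ a : ((UnitaryGroup.cmDatum L 2 (Matrix.of fun i j : Fin 2 => if i.val + j.val + 1 = 2 then (1 : L) else 0)).Local v × (UnitaryGroup.cmDatum L 1 (Matrix.of fun i j : Fin 1 => if i.val + j.val + 1 = 1 then (1 : L) else 0)).Local v), MeasurableSpace (((UnitaryGroup.cmDatum L 2 (Matrix.of fun i j : Fin 2 => if i.val + j.val + 1 = 2 then (1 : L) else 0)).Local v × (UnitaryGroup.cmDatum L 1 (Matrix.of fun i j : Fin 1 => if i.val + j.val + 1 = 1 then (1 : L) else 0)).Local v) ⧸ Subgroup.centralizer ({a} : Set (((UnitaryGroup.cmDatum L 2 (Matrix.of fun i j : Fin 2 => if i.val + j.val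 + 1 = 2 then (1 : L) else 0)).Local v × (UnitaryGroup.cmDatum L 1 (Matrix.of fun i j : Fin 1 => if i.val + j.val + 1 = 1 then (1 : L) else 0)).Local v)))) := fun _ => borel _
    haveI : ∀ a : ((UnitaryGroup.cmDatum L 2 (Matrix.of fun i j : Fin 2 => if i.val + j.val + 1 = 2 then (1 : L) else 0)).Local v × (UnitaryGroup.cmDatum L 1 (Matrix.of fun i j : Fin 1 => if i.val + j.val + 1 = 1 then (1 : L) else 0)).Local v), BorelSpace (((UnitaryGroup.cmDatum L 2 (Matrix.of fun i j : Fin 2 => if i.val + j.val + 1 = 2 then (1 : L) else 0)).Local v × (UnitaryGroup.cmDatum L 1 (Matrix.of fun i j : Fin 1 => if i.val + j.val + 1 = 1 then (1 : L) else 0)).Local v) ⧸ Subgroup.centralizer ({a} : Set (((UnitaryGroup.cmDatum L 2 (Matrix.of fun i j : Fin 2 => if i.val + j.val + 1 = 2 then (1 : L) else 0)).Local v × (UnitaryGroup.cmDatum L 1 (Matrix.of fun i j : Fin 1 => if i.val + j.val + 1 = 1 then (1 : L) else 0)).Local v)))) := fun _ => ⟨rfl⟩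
    letI : ∀ γ : Gqs L v, MeasurableSpace (Gqs L v ⧸ Subgroup.centralizer ({γ} : Set (Gqs L v))) := fun _ => borel _
    haveI : ∀ γ : Gqs L v, BorelSpace (Gqs L v ⧸ Subgroup.centralizer ({γ} : Set (Gqs L v))) := fun _ => ⟨rfl⟩
    ∀ (mHv : OrbitalMeasureFamily (((UnitaryGroup.cmDatum L 2 (Matrix.of fun i j : Fin 2 => if i.val + j.val + 1 = 2 then (1 : L) else 0)).Local v × (UnitaryGroup.cmDatum L 1 (Matrix.of fun i j : Fin 1 => if i.val + j.val + 1 = 1 then (1 : L) else 0)).Local v))) (mQv : OrbitalMeasureFamily (Gqs L v)),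
      mHv.IsCanonical (IsLocalGRegular L v) νHv →
      mQv.IsCanonical (fun γ => IsRegularElt (γ.val : GL (Fin 3) (UnitaryGroup.LocalRing L v))) νQv →
      IsLocalDeltaTransferExists L (qsForm L) v ((finExplicitCollection L (qsForm L) μ (finExplicitDelta_conj_left_all L (qsForm L) μ) (finExplicitDelta_conj_right_all L (qsForm L) μ)) v) mHv mQv IsLocSmooth IsLocSmooth →
      ∀ (π₁ πSt : IrrClass (((UnitaryGroup.cmDatum L 2 (Matrix.of fun i j : Fin 2 => if i.val + j.val + 1 = 2 then (1 : L) else 0)).Local v × (UnitaryGroup.cmDatum L 1 (Matrix.of fun i j : Fin 1 => if i.val + j.val + 1 = 1 then (1 : L) else 0)).Local v))),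
        HLengthTwoLabels L v
          (torusCharPair (conjLocal L (IsCMField.complexConj L) v) (cmLocalForm L 2 v) (cmLocalForm_eq_over L 2 v) 0
            ((torusLocalComponent L (IsCMField.complexConj L) v ξ.η).comp
                (quotConj (conjLocal L (IsCMField.complexConj L) v) (conjLocal_conjLocal_cm L v)) *
              halfModulusChar (UnitaryGroup.LocalRing L v))
            (torusLocalComponent L (IsCMField.complexConj L) v ξ.ψ))
          ((torusLocalComponent L (IsCMField.complexConj L) v ξ.ψ).comp (localDet (IsCMField.complexConj L) v (isUnit_antidiagOne_det L 1))) π₁ πSt →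
        (∀ fH : ((UnitaryGroup.cmDatum L 2 (Matrix.of fun i j : Fin 2 => if i.val + j.val + 1 = 2 then (1 : L) else 0)).Local v × (UnitaryGroup.cmDatum L 1 (Matrix.of fun i j : Fin 1 => if i.val + j.val + 1 = 1 then (1 : L) else 0)).Local v) → ℂ, IsLocSmooth fH → π₁.smoothTrace νHv fH = charDist (ξ.xiLocalChar v) νHv fH) →
      ∀ [MeasurableSpace (Gqs L v ⧸ Subgroup.center (Gqs L v))] [BorelSpace (Gqs L v ⧸ Subgroup.center (Gqs L v))]
        (μZ : Measure (Gqs L v ⧸ Subgroup.center (Gqs L v))) [μZ.IsHaarMeasure],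
      ∀ (𝔇 : Ch12Sec5.EllipticData (Gqs L v) (((UnitaryGroup.cmDatum L 2 (Matrix.of fun i j : Fin 2 => if i.val + j.val + 1 = 2 then (1 : L) else 0)).Local v × (UnitaryGroup.cmDatum L 1 (Matrix.of fun i j : Fin 1 => if i.val + j.val + 1 = 1 then (1 : L) else 0)).Local v))) (d : IrrClass (Gqs L v) → ℝ) (T : Subgroup (Gqs L v))
        (par : IrrClass (Gqs L v) → (((UnitaryGroup.LocalRing L v)ˣ →* ℂˣ) × (↥(normOneUnits (conjLocal L (IsCMField.complexConj L) v)) →* ℂˣ))) (μv : (UnitaryGroup.LocalRing L v)ˣ →* ℂˣ),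
      𝔇.μG = νQv →  -- hC01
      𝔇.μH = νHv →  -- hC02
      𝔇.μGZ = μZ →  -- hC03
      𝔇.orb = mQv →  -- hC04
      (∀ γ : Gqs L v, γ ∈ 𝔇.regG ↔ IsRegularElt (γ.val : GL (Fin 3) (UnitaryGroup.LocalRing L v))) →  -- hC05
      (∀ (φ : Gqs L v → ℂ) (fH : ((UnitaryGroup.cmDatum L 2 (Matrix.of fun i j : Fin 2 => if i.val + j.val + 1 = 2 then (1 : L) else 0)).Local v × (UnitaryGroup.cmDatum L 1 (Matrix.of fun i j : Fin 1 => if i.val + j.val + 1 = 1 then (1 : L) else 0)).Local v) → ℂ), 𝔇.IsTransfer φ fH ↔ IsLocalDeltaTransfer L (qsForm L) v ((finExplicitCollection L (qsForm L) μ (finExplicitDelta_conj_left_all L (qsForm L) μ) (finExplicitDelta_conj_right_all L (qsForm L) μ)) v) mHv mQv fH φ) →  -- hC06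
      ({πSt} : Finset (IrrClass (((UnitaryGroup.cmDatum L 2 (Matrix.of fun i j : Fin 2 => if i.val + j.val + 1 = 2 then (1 : L) else 0)).Local v × (UnitaryGroup.cmDatum L 1 (Matrix.of fun i j : Fin 1 => if i.val + j.val + 1 = 1 then (1 : L) else 0)).Local v)))) ∈ 𝔇.sqPacketsH →  -- hC07
      (∀ γ : Gqs L v, γ ∈ 𝔇.ellG ↔ IsRegularElt (γ.val : GL (Fin 3) (UnitaryGroup.LocalRing L v)) ∧ γ ∉ hyperbolicSet L v) →  -- hE
      (∀ π : IrrClass (Gqs L v), Measurable (𝔇.char π) ∧ LocallyIntegrable (𝔇.char π) 𝔇.μG ∧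
          (∀ x ∈ 𝔇.regG, ∀ᶠ y in 𝓝 x, 𝔇.char π y = 𝔇.char π x) ∧
          ∀ φ : Gqs L v → ℂ, IsLocSmooth φ → π.smoothTrace 𝔇.μG φ = ∫ x, φ x * 𝔇.char π x ∂𝔇.μG) →  -- hchar
      (∀ T : Subgroup (Gqs L v), T ∈ 𝔇.cartanAll ↔ T = (cmBorelTriple L 3 v).M ∨ T ∈ 𝔇.cartanG) →  -- hAll
      (𝔇.μT (cmBorelTriple L 3 v).M).IsHaarMeasure →  -- hHaar
      (∀ T ∈ 𝔇.cartanG, IsCompact (T : Set (Gqs L v)) ∧ ∃ γ₀ : Gqs L v, IsRegularElt (γ₀.val : GL (Fin 3) (UnitaryGroup.LocalRing L v)) ∧ T = Subgroup.centralizer ({γ₀} : Set (Gqs L v))) →  -- hcart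
      (∀ T ∈ 𝔇.cartanG, (𝔇.μT T).IsHaarMeasure) →  -- hHaarG
      (∀ T ∈ 𝔇.cartanG, IsFiniteMeasure (𝔇.μT T)) →  -- hfinG
      (∀ T ∈ 𝔇.cartanG, ∃ s : Finset (Subgroup ↥T), (∀ K ∈ s, IsClosed (K : Set ↥T) ∧ ¬ IsOpen (K : Set ↥T)) ∧ ∀ t : ↥T, ¬ IsRegularElt ((t : Gqs L v).val : GL (Fin 3) (UnitaryGroup.LocalRing L v)) → ∃ K ∈ s, t ∈ K) →  -- hker
      (∀ g : Gqs L v, 𝔇.DG g = ((NNReal.sqrt (NNReal.sqrt ((∏ w : PlacesOver L v, IsNonarchimedeanLocalField.normAbs (w.1.adicCompletion L) (((g.val : GL (Fin 3) (UnitaryGroup.LocalRing L v)).val.charpoly.discr) w)) * ((∏ w : PlacesOver L v, IsNonarchimedeanLocalField.normAbs (w.1.adicCompletion L) (((g.val : GL (Fin 3) (UnitaryGroup.LocalRing L v)).val.det) w)) ^ 2)⁻¹)) : ℝ≥0) : ℝ)) →  -- eDG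
      (∀ s : ((UnitaryGroup.cmDatum L 2 (Matrix.of fun i j : Fin 2 => if i.val + j.val + 1 = 2 then (1 : L) else 0)).Local v × (UnitaryGroup.cmDatum L 1 (Matrix.of fun i j : Fin 1 => if i.val + j.val + 1 = 1 then (1 : L) else 0)).Local v), 𝔇.DH s = ((NNReal.sqrt (NNReal.sqrt ((∏ w : PlacesOver L v, IsNonarchimedeanLocalField.normAbs (w.1.adicCompletion L) (((s.1.val : GL (Fin 2) (UnitaryGroup.LocalRing L v)).val.charpoly.discr) w)) * (∏ w : PlacesOver L v, IsNonarchimedeanLocalField.normAbs (w.1.adicCompletion L) (((s.1.val : GL (Fin 2) (UnitaryGroup.LocalRing L v)).val.det) w))⁻¹)) : ℝ≥0) : ℝ)) →  -- eDH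
      (∀ T ∈ 𝔇.cartanH, IsCompact (T : Set ((UnitaryGroup.cmDatum L 2 (Matrix.of fun i j : Fin 2 => if i.val + j.val + 1 = 2 then (1 : L) else 0)).Local v × (UnitaryGroup.cmDatum L 1 (Matrix.of fun i j : Fin 1 => if i.val + j.val + 1 = 1 then (1 : L) else 0)).Local v))) →  -- hKH
      (∀ T ∈ 𝔇.cartanH, IsFiniteMeasure (𝔇.μTH T)) →  -- hFH
      (∀ ρ ∈ 𝔇.sqPacketsH, ∀ T ∈ 𝔇.cartanH, ∀ C : Set ((UnitaryGroup.cmDatum L 2 (Matrix.of fun i j : Fin 2 => if i.val + j.val + 1 = 2 then (1 : L) else 0)).Local v × (UnitaryGroup.cmDatum L 1 (Matrix.of fun i j : Fin 1 => if i.val + j.val + 1 = 1 then (1 : L) else 0)).Local v), IsCompact C → C ⊆ (T : Set ((UnitaryGroup.cmDatum L 2 (Matrix.of fun i j : Fin 2 => if i.val + j.val + 1 = 2 then (1 : L) else 0)).Local v × (UnitaryGroup.cmDatum L 1 (Matrix.of fun i j : Fin 1 => if i.val + j.val + 1 = 1 then (1 : L) else 0)).Local v)) → ∃ B : ℝ,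 ∀ γ ∈ C, ‖(𝔇.DH γ : ℂ) * 𝔇.packetCharH ρ γ‖ ≤ B) →  -- hHBH
      (∀ π : IrrClass (Gqs L v), ¬ π.IsSquareIntegrable μZ → π.IsConstituentOf (UnitaryGroup.cmPrincipalSeries L 3 v (UnitaryGroup.cmTorusCharPair L v (par π).1 (par π).2)) ∧ Continuous (par π).1 ∧ Continuous (par π).2) →  -- hNL
      (∀ π : IrrClass (Gqs L v), (∃ (χ₁ : (UnitaryGroup.LocalRing L v)ˣ →* ℂˣ) (χ₂ : ↥(normOneUnits (conjLocal L (IsCMField.complexConj L) v)) →* ℂˣ), Continuous (fun x => ((χ₁ x : ℂˣ) : ℂ)) ∧ Continuous (fun x => ((χ₂ x : ℂˣ) : ℂ)) ∧ (UnitaryGroup.cmPrincipalSeries L 3 v (UnitaryGroup.cmTorusCharPair L v χ₁ χ₂)).IsIrreducible ∧ π.IsConstituentOf (UnitaryGroup.cmPrincipalSeries L 3 v (UnitaryGroup.cmTorusCharPair L v χ₁ χ₂))) → (UnitaryGroup.cmPrincipalSeries L 3 v (UnitaryGroup.cmTorusCharPair L v (par π).1 (par π).2)).IsIrreducible ∧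 π.IsConstituentOf (UnitaryGroup.cmPrincipalSeries L 3 v (UnitaryGroup.cmTorusCharPair L v (par π).1 (par π).2)) ∧ Continuous (par π).1 ∧ Continuous (par π).2 ∧ Continuous (fun x => (((par π).1 x : ℂˣ) : ℂ)) ∧ Continuous (fun x => (((par π).2 x : ℂˣ) : ℂ)) ∧ ∀ (ν : Measure (Gqs L v)) (f : Gqs L v → ℂ), π.smoothTrace ν f = Representation.smoothTrace (G := Gqs L v) (UnitaryGroup.cmPrincipalSeries L 3 v (UnitaryGroup.cmTorusCharPair L v (par π).1 (par π).2)) ν f) →  -- hPSpar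
      (∀ P : Finset (IrrClass (Gqs L v)), P ∈ 𝔇.ldsPackets ↔ (P.card = 2 ∧ ∃ (χ₁ : (UnitaryGroup.LocalRing L v)ˣ →* ℂˣ) (χ₂ : ↥(normOneUnits (conjLocal L (IsCMField.complexConj L) v)) →* ℂˣ), Continuous (fun x => ((χ₁ x : ℂˣ) : ℂ)) ∧ Continuous (fun x => ((χ₂ x : ℂˣ) : ℂ)) ∧ (∀ a : (UnitaryGroup.LocalRing L v)ˣ, (conjLocal L (IsCMField.complexConj L) v) (a : UnitaryGroup.LocalRing L v) = a → χ₁ a = 1) ∧ χ₁ ≠ 1 ∧ ∀ c : IrrClass (Gqs L v), c ∈ P ↔ c.IsConstituentOf (UnitaryGroup.cmPrincipalSeries L 3 v (UnitaryGroup.cmTorusCharPair L v χ₁ χ₂)))) →  -- hLdsF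
      (∀ (χ₁ : (UnitaryGroup.LocalRing L v)ˣ →* ℂˣ) (χ₂ : ↥(normOneUnits (conjLocal L (IsCMField.complexConj L) v)) →* ℂˣ), Continuous (fun x => ((χ₁ x : ℂˣ) : ℂ)) → Continuous (fun x => ((χ₂ x : ℂˣ) : ℂ)) → ∀ π π' : IrrClass (Gqs L v), ¬ π.IsSquareIntegrable μZ → ¬ π'.IsSquareIntegrable μZ → π.IsConstituentOf (UnitaryGroup.cmPrincipalSeries L 3 v (UnitaryGroup.cmTorusCharPair L v χ₁ χ₂)) → π'.IsConstituentOf (UnitaryGroup.cmPrincipalSeries L 3 v (UnitaryGroup.cmTorusCharPair L v χ₁ χ₂)) → par π = par π') →  -- hW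
      UnitaryGroup.IsQuadraticCharExtension (conjLocal L (IsCMField.complexConj L) v) μv →  -- hμq
      (Continuous (fun x => ((μv x : ℂˣ) : ℂ))) →  -- hμc
      (∀ a b : ((UnitaryGroup.cmDatum L 2 (Matrix.of fun i j : Fin 2 => if i.val + j.val + 1 = 2 then (1 : L) else 0)).Local v × (UnitaryGroup.cmDatum L 1 (Matrix.of fun i j : Fin 1 => if i.val + j.val + 1 = 1 then (1 : L) else 0)).Local v), 𝔇.stConjH a b ↔ IsLocalStablyConjH L v a b) →  -- hStH
      (∀ a : ((UnitaryGroup.cmDatum L 2 (Matrix.of fun i j : Fin 2 => if i.val + j.val + 1 = 2 then (1 : L) else 0)).Local v × (UnitaryGroup.cmDatum L 1 (Matrix.of fun i j : Fin 1 => if i.val + j.val + 1 = 1 then (1 : L) else 0)).Local v), IsLocalGRegular L v a → a ∈ 𝔇.regH) →  -- hRegH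
      (∀ (α : ((UnitaryGroup.cmDatum L 2 (Matrix.of fun i j : Fin 2 => if i.val + j.val + 1 = 2 then (1 : L) else 0)).Local v × (UnitaryGroup.cmDatum L 1 (Matrix.of fun i j : Fin 1 => if i.val + j.val + 1 = 1 then (1 : L) else 0)).Local v) → ℂ) (x : Gqs L v), 𝔇.up α x = if IsRegularElt (x.val : GL (Fin 3) (UnitaryGroup.LocalRing L v)) then ((𝔇.DG x : ℂ))⁻¹ * ∑ᶠ q : Quot (IsLocalStablyConjH L v), (if IsLocalGRegular L v q.out ∧ IsLocalNormPair L (qsForm L) v q.out x then finTau L v q.out μ * (𝔇.DH q.out : ℂ) * ((finKappaAt L v (qsForm L) q.out x : ℤ) : ℂ) * α q.out else 0) else 0) →  -- hUp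
      (∀ ρ ∈ 𝔇.sqPacketsH, ∀ C : Set ((UnitaryGroup.cmDatum L 2 (Matrix.of fun i j : Fin 2 => if i.val + j.val + 1 = 2 then (1 : L) else 0)).Local v × (UnitaryGroup.cmDatum L 1 (Matrix.of fun i j : Fin 1 => if i.val + j.val + 1 = 1 then (1 : L) else 0)).Local v), IsCompact C → ∃ B : ℝ, ∀ s ∈ C, IsLocalGRegular L v s → ‖(𝔇.DH s : ℂ) * 𝔇.packetCharH ρ s‖ ≤ B) →  -- hHBHP
      (∃ (c : ℝ) (_ : c ≠ 0) (ι : Type) (S : Finset ι) (Λ : ι → ((Gqs L v) → ℂ) → ℂ) (Γ : ι → (Gqs L v) → ℂ) (γseq : ℕ → Gqs L v) (q : ℂ) (a : ι → ℕ) (g : ι → ℂ), (∀ f : (Gqs L v) → ℂ, IsLocSmooth f → ∀ᶠ γ in 𝓝[((T : Set (Gqs L v)) ∩ {γ | IsRegularElt (γ.val : GL (Fin 3) (UnitaryGroup.LocalRing L v))})] (1 : Gqs L v), classOrbitalIntegral mQv f (ConjClasses.mk γ) = (c : ℂ) * f 1 + ∑ u ∈ S, Λ u f * Γ u γ) ∧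 (∀ n, γseq n ∈ (T : Set (Gqs L v)) ∧ IsRegularElt ((γseq n).val : GL (Fin 3) (UnitaryGroup.LocalRing L v))) ∧ Tendsto γseq atTop (𝓝 (1 : Gqs L v)) ∧ 1 < ‖q‖ ∧ (∀ u ∈ S, 1 ≤ a u) ∧ ∀ u ∈ S, ∀ n, Γ u (γseq n) = q ^ (n * a u) * g u) →  -- hGerm
      (∀ ξ' : ((UnitaryGroup.cmDatum L 2 (Matrix.of fun i j : Fin 2 => if i.val + j.val + 1 = 2 then (1 : L) else 0)).Local v × (UnitaryGroup.cmDatum L 1 (Matrix.of fun i j : Fin 1 => if i.val + j.val + 1 = 1 then (1 : L) else 0)).Local v) →* ℂˣ, Continuous ξ' → ∃ (η₁ η₂ : ↥(normOneUnits (conjLocal L (IsCMField.complexConj L) v)) →* ℂˣ), Continuous (fun x => ((η₁ x : ℂˣ) : ℂ)) ∧ Continuous (fun x => ((η₂ x : ℂˣ) : ℂ)) ∧ KeysCaseTwoLabels L v μv η₁ η₂ (𝔇.pi2 ξ') (𝔇.piN ξ')) →  -- hlabels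
      (∀ ψ' : ↥(Subgroup.center (Gqs L v)) →* ℂˣ, Continuous ψ' → ∃ ψ : ↥(normOneUnits (conjLocal L (IsCMField.complexConj L) v)) →* ℂˣ, Continuous ψ ∧ 𝔇.stG ψ' ≠ 𝔇.detG ψ' ∧ ∀ c : IrrClass (Gqs L v), c.IsConstituentOf (UnitaryGroup.cmPrincipalSeries L 3 v (UnitaryGroup.cmTorusCharPair L v (halfModulusChar (UnitaryGroup.LocalRing L v) * halfModulusChar (UnitaryGroup.LocalRing L v))⁻¹ ψ)) ↔ (c = 𝔇.stG ψ' ∨ c = 𝔇.detG ψ')) →  -- hSt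
      (∀ ψ₀ : ↥(normOneUnits (conjLocal L (IsCMField.complexConj L) v)) →* ℂˣ, Continuous (fun x => ((ψ₀ x : ℂˣ) : ℂ)) → ∃ ψ : ↥(Subgroup.center (Gqs L v)) →* ℂˣ, Continuous ψ ∧ ∀ c : IrrClass (Gqs L v), c.IsConstituentOf (UnitaryGroup.cmPrincipalSeries L 3 v (UnitaryGroup.cmTorusCharPair L v (halfModulusChar (UnitaryGroup.LocalRing L v) * halfModulusChar (UnitaryGroup.LocalRing L v))⁻¹ ψ₀)) ↔ (c = 𝔇.stG ψ ∨ c = 𝔇.detG ψ)) →  -- hStJH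
      (∀ (η₁ η₂ : ↥(normOneUnits (conjLocal L (IsCMField.complexConj L) v)) →* ℂˣ), Continuous (fun x => ((η₁ x : ℂˣ) : ℂ)) → Continuous (fun x => ((η₂ x : ℂˣ) : ℂ)) → ∃ ξ' : ((UnitaryGroup.cmDatum L 2 (Matrix.of fun i j : Fin 2 => if i.val + j.val + 1 = 2 then (1 : L) else 0)).Local v × (UnitaryGroup.cmDatum L 1 (Matrix.of fun i j : Fin 1 => if i.val + j.val + 1 = 1 then (1 : L) else 0)).Local v) →* ℂˣ, Continuous ξ' ∧ KeysCaseTwoLabels L v μv η₁ η₂ (𝔇.pi2 ξ') (𝔇.piN ξ')) →  -- hKeysJH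
      (∀ ρ ∈ 𝔇.sqPacketsH, ∀ a : ((UnitaryGroup.cmDatum L 2 (Matrix.of fun i j : Fin 2 => if i.val + j.val + 1 = 2 then (1 : L) else 0)).Local v × (UnitaryGroup.cmDatum L 1 (Matrix.of fun i j : Fin 1 => if i.val + j.val + 1 = 1 then (1 : L) else 0)).Local v), IsLocalGRegular L v a → ∀ᶠ a' in 𝓝 a, 𝔇.packetCharH ρ a' = 𝔇.packetCharH ρ a) →  -- hM1lc
      (∀ γ : Gqs L v, IsRegularElt (γ.val : GL (Fin 3) (UnitaryGroup.LocalRing L v)) → ∃ T' ∈ 𝔇.cartanAll, ∃ x : Gqs L v, ∀ g : Gqs L v, g ∈ Subgroup.centralizer ({γ} : Set (Gqs L v)) ↔ x⁻¹ * g * x ∈ T') →  -- hcovA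
      (∀ T' ∈ 𝔇.cartanAll, ∀ T'' ∈ 𝔇.cartanAll, T' ≠ T'' → ∀ y : Gqs L v, ¬ ∀ h : Gqs L v, h ∈ T'' ↔ y⁻¹ * h * y ∈ T') →  -- hncA
      (∀ T' ∈ 𝔇.cartanAll, T' ≠ (cmBorelTriple L 3 v).M → IsCompact (T' : Set (Gqs L v))) →  -- hcptA
      (∀ T' ∈ 𝔇.cartanAll, (𝔇.μT T').IsInvInvariant) →  -- hinvT
      (∀ T' ∈ 𝔇.cartanAll, 𝔇.μT T' (compactCore ↥T') = 1) →  -- hcoreT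
      (∀ π ∈ 𝔇.irredPS, ∃ (χ₁ : (UnitaryGroup.LocalRing L v)ˣ →* ℂˣ) (χ₂ : ↥(normOneUnits (conjLocal L (IsCMField.complexConj L) v)) →* ℂˣ), Continuous (fun x => ((χ₁ x : ℂˣ) : ℂ)) ∧ Continuous (fun x => ((χ₂ x : ℂˣ) : ℂ)) ∧ (UnitaryGroup.cmPrincipalSeries L 3 v (UnitaryGroup.cmTorusCharPair L v χ₁ χ₂)).IsIrreducible ∧ π.IsConstituentOf (UnitaryGroup.cmPrincipalSeries L 3 v (UnitaryGroup.cmTorusCharPair L v χ₁ χ₂))) →  -- hIrr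
      (∀ ξ' : ((UnitaryGroup.cmDatum L 2 (Matrix.of fun i j : Fin 2 => if i.val + j.val + 1 = 2 then (1 : L) else 0)).Local v × (UnitaryGroup.cmDatum L 1 (Matrix.of fun i j : Fin 1 => if i.val + j.val + 1 = 1 then (1 : L) else 0)).Local v) →* ℂˣ, (𝔇.pi2 ξ').IsSquareIntegrable 𝔇.μGZ ∧ ¬ (𝔇.piN ξ').IsSquareIntegrable 𝔇.μGZ) →  -- hKeys
      (∀ γ ∈ T, IsRegularElt (γ.val : GL (Fin 3) (UnitaryGroup.LocalRing L v)) → ∀ c : UnitaryGroup.LocalRing L v, ¬ ((γ.val.val : Matrix (Fin 3) (Fin 3) (UnitaryGroup.LocalRing L v)).charpoly).IsRoot c) →  -- hT3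
      𝔇.DetNotL2 →  -- hDet
      (∀ (χ₁ : (UnitaryGroup.LocalRing L v)ˣ →* ℂˣ) (χ₂ : ↥(normOneUnits (conjLocal L (IsCMField.complexConj L) v)) →* ℂˣ), Continuous (fun x => ((χ₁ x : ℂˣ) : ℂ)) → Continuous (fun x => ((χ₂ x : ℂˣ) : ℂ)) → (∃ N : Subrepresentation (UnitaryGroup.cmPrincipalSeries L 3 v (UnitaryGroup.cmTorusCharPair L v χ₁ χ₂)), N ≠ ⊥ ∧ N ≠ ⊤) → (χ₁ = halfModulusChar (UnitaryGroup.LocalRing L v) * halfModulusChar (UnitaryGroup.LocalRing L v) ∨ χ₁ = (halfModulusChar (UnitaryGroup.LocalRing L v) * halfModulusChar (UnitaryGroup.LocalRing L v))⁻¹) ∨ (∃ η : (UnitaryGroup.LocalRing L v)ˣ →* ℂˣ, IsQuadraticCharExtension (conjLocal L (IsCMField.complexConj L) v) η ∧ Continuous (fun x => ((η x : ℂˣ) : ℂ)) ∧ (χ₁ = η * halfModulusChar (UnitaryGroup.LocalRing L v) ∨ χ₁ = η * (halfModulusChar (UnitaryGroup.LocalRing L v))⁻¹)) ∨ (χ₁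 ≠ 1 ∧ ∀ a : (UnitaryGroup.LocalRing L v)ˣ, (conjLocal L (IsCMField.complexConj L) v) (a : UnitaryGroup.LocalRing L v) = a → χ₁ a = 1)) →  -- hKeysRed
      (∀ (χ₁ : (UnitaryGroup.LocalRing L v)ˣ →* ℂˣ) (χ₂ : ↥(normOneUnits (conjLocal L (IsCMField.complexConj L) v)) →* ℂˣ), Continuous (fun x => ((χ₁ x : ℂˣ) : ℂ)) → Continuous (fun x => ((χ₂ x : ℂˣ) : ℂ)) → (∀ a : (UnitaryGroup.LocalRing L v)ˣ, (conjLocal L (IsCMField.complexConj L) v) (a : UnitaryGroup.LocalRing L v) = a → χ₁ a = 1) → χ₁ ≠ 1 → ∃ P : Finset (IrrClass (Gqs L v)), P.card = 2 ∧ ∀ c : IrrClass (Gqs L v), c ∈ P ↔ c.IsConstituentOf (UnitaryGroup.cmPrincipalSeries L 3 v (UnitaryGroup.cmTorusCharPair L v χ₁ χ₂))) →  -- hLdsTwo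
      LocallyIntegrable (fun x : Gqs L v => (𝔇.DG x)⁻¹) 𝔇.μG →  -- hDGli
      𝔇.Prop1252 →  -- h1252
      (∀ π : IrrClass (Gqs L v), 𝔇.IsEllipticRep π → ¬ π.IsSupercuspidal → ¬ ((Algebra.IsUnramifiedIn (𝓞 L) v.asIdeal ∨ Valued.v (2 : v.adicCompletion ↥(maximalRealSubfield L)) = 1) ∧ ∃ ψ : ↥(Subgroup.center (Gqs L v)) →* ℂˣ, Continuous ψ ∧ (π = 𝔇.stG ψ ∨ π = 𝔇.detG ψ)) → ∃ f : Gqs L v → ℂ, 𝔇.IsPseudoCoeff π f) →  -- hPCEnsNW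
      (∀ σ : IrrClass (Gqs L v), 𝔇.IsL2 σ → ¬ σ.IsSupercuspidal → ¬ ((Algebra.IsUnramifiedIn (𝓞 L) v.asIdeal ∨ Valued.v (2 : v.adicCompletion ↥(maximalRealSubfield L)) = 1) ∧ ∃ ψ : ↥(Subgroup.center (Gqs L v)) →* ℂˣ, Continuous ψ ∧ σ = 𝔇.stG ψ) → 𝔇.innerG (𝔇.char σ) (𝔇.char σ) = 1) →  -- hL2oneNsNW
      (∀ π π' : IrrClass (Gqs L v), 𝔇.IsEllipticRep π → 𝔇.IsEllipticRep π' → ¬ π.IsSupercuspidal → ¬ π'.IsSupercuspidal → 𝔇.innerG (𝔇.char π) (𝔇.char π') ≠ 0 → π ≠ π' → 𝔇.IsEllipticPair π π') →  -- h61bNs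
      (∀ P ∈ 𝔇.ldsPackets, ∀ π ∈ P, 𝔇.innerG (𝔇.char π) (𝔇.char π) = 1) →  -- hLdsOne
      𝔇.PacketCharHRegularity →  -- hM1H
      𝔇.PacketCharHNorm →  -- hM5
      𝔇.LdsPseudoCoeffTraceH ({πSt} : Finset (IrrClass (((UnitaryGroup.cmDatum L 2 (Matrix.of fun i j : Fin 2 => if i.val + j.val + 1 = 2 then (1 : L) else 0)).Local v × (UnitaryGroup.cmDatum L 1 (Matrix.of fun i j : Fin 1 => if i.val + j.val + 1 = 1 then (1 : L) else 0)).Local v)))) →  -- hR0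
      (∀ ψ' : ↥(Subgroup.center (Gqs L v)) →* ℂˣ, Continuous ψ' → 𝔇.IsL2 (𝔇.stG ψ')) →  -- hStL2
      (∀ (π : IrrClass (Gqs L v)) (f : Gqs L v → ℂ), 𝔇.IsL2 π → 𝔇.IsPseudoCoeff π f → f 1 = (d π : ℂ)) →  -- hPL
      (∀ π : IrrClass (Gqs L v), 𝔇.IsL2 π → 0 < d π) →  -- hdpos
      normalizedCharacter_locallyBounded →  -- hHCB
      (∀ π : IrrClass (Gqs L v), (∃ (χ₁ : (UnitaryGroup.LocalRing L v)ˣ →* ℂˣ) (χ₂ : ↥(normOneUnits (conjLocal L (IsCMField.complexConj L) v)) →* ℂˣ), Continuous (fun x => ((χ₁ x : ℂˣ) : ℂ)) ∧ Continuous (fun x => ((χ₂ x : ℂˣ) : ℂ)) ∧ (UnitaryGroup.cmPrincipalSeries L 3 v (UnitaryGroup.cmTorusCharPair L v χ₁ χ₂)).IsIrreducible ∧ π.IsConstituentOf (UnitaryGroup.cmPrincipalSeries L 3 v (UnitaryGroup.cmTorusCharPair L v χ₁ χ₂))) → π ∈ 𝔇.irredPS) →  -- eIrr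
      (∃ (ιZ : ↥(normOneUnits (conjLocal L (IsCMField.complexConj L) v)) →* ↥(Subgroup.center (Gqs L v))) (detZ : (Gqs L v) →* ↥(Subgroup.center (Gqs L v))), Continuous ιZ ∧ Continuous detZ ∧ (∀ z : ↥(normOneUnits (conjLocal L (IsCMField.complexConj L) v)), ((ιZ z).val.val.val : Matrix (Fin 3) (Fin 3) (UnitaryGroup.LocalRing L v)) = (((z : (UnitaryGroup.LocalRing L v)ˣ) : UnitaryGroup.LocalRing L v)) • (1 : Matrix (Fin 3) (Fin 3) (UnitaryGroup.LocalRing L v))) ∧ (∀ g : (Gqs L v), ((detZ g).val.val.val : Matrix (Fin 3) (Fin 3) (UnitaryGroup.LocalRing L v)) = (g.val.val : Matrix (Fin 3) (Fin 3) (UnitaryGroup.LocalRing L v)).det • (1 : Matrix (Fin 3) (Fin 3) (UnitaryGroup.LocalRing L v))) ∧ ∀ ψ : ↥(Subgroup.center (Gqs L v)) →* ℂˣ, Continuous ψ → (∃ hopen : IsOpen (((ψ.comp detZ).ker : Subgroup (Gqs L v)) : Set (Gqs L v)), 𝔇.detG ψ = IrrClass.mk (SmoothIrrep.ofChar (ψ.comp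 detZ) hopen)) ∧ 𝔇.stG ψ ≠ 𝔇.detG ψ ∧ (∀ c : IrrClass (Gqs L v), c.IsConstituentOf (cmPrincipalSeries L 3 v (cmTorusCharPair L v (halfModulusChar (UnitaryGroup.LocalRing L v) * halfModulusChar (UnitaryGroup.LocalRing L v))⁻¹ (ψ.comp ιZ))) ↔ (c = 𝔇.stG ψ ∨ c = 𝔇.detG ψ)) ∧ (𝔇.stG ψ).IsSquareIntegrable μZ ∧ ¬ (𝔇.detG ψ).IsSquareIntegrable μZ) →  -- eSt
        𝔇.μG = νQv ∧ 𝔇.μH = νHv ∧ 𝔇.μGZ = μZ ∧ 𝔇.orb = mQv ∧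
        (∀ γ : Gqs L v, γ ∈ 𝔇.regG ↔ IsRegularElt (γ.val : GL (Fin 3) (UnitaryGroup.LocalRing L v))) ∧
        (∀ (φ : Gqs L v → ℂ) (fH : ((UnitaryGroup.cmDatum L 2 (Matrix.of fun i j : Fin 2 => if i.val + j.val + 1 = 2 then (1 : L) else 0)).Local v × (UnitaryGroup.cmDatum L 1 (Matrix.of fun i j : Fin 1 => if i.val + j.val + 1 = 1 then (1 : L) else 0)).Local v) → ℂ), 𝔇.IsTransfer φ fH ↔ IsLocalDeltaTransfer L (qsForm L) v ((finExplicitCollection L (qsForm L) μ (finExplicitDelta_conj_left_all L (qsForm L) μ) (finExplicitDelta_conj_right_all L (qsForm L) μ)) v) mHv mQv fH φ) ∧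
        ({πSt} : Finset (IrrClass (((UnitaryGroup.cmDatum L 2 (Matrix.of fun i j : Fin 2 => if i.val + j.val + 1 = 2 then (1 : L) else 0)).Local v × (UnitaryGroup.cmDatum L 1 (Matrix.of fun i j : Fin 1 => if i.val + j.val + 1 = 1 then (1 : L) else 0)).Local v)))) ∈ 𝔇.sqPacketsH ∧
        𝔇.WeylIntegrationFormula ∧ 𝔇.UpSpecLB ∧ 𝔇.Prop1252 ∧ Ch12Sec6.PseudoCoeffExists 𝔇 ∧
        Ch12Sec6.Prop1261a 𝔇 ∧ Ch12Sec6.Prop1261b 𝔇 ∧ Ch12Sec6.Prop1261c 𝔇 ∧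
        Ch12Sec6.LdsCharactersOpposite 𝔇 ∧ Ch12Sec6.EllipticOfNotPrincipalSeries 𝔇 ∧ Ch12Sec6.EllipticClassification 𝔇 ∧
        (∀ π : IrrClass (Gqs L v), Measurable (𝔇.char π) ∧ LocallyIntegrable (𝔇.char π) 𝔇.μG ∧
          (∀ x ∈ 𝔇.regG, ∀ᶠ y in 𝓝 x, 𝔇.char π y = 𝔇.char π x) ∧
          ∀ φ : Gqs L v → ℂ, IsLocSmooth φ → π.smoothTrace 𝔇.μG φ = ∫ x, φ x * 𝔇.char π x ∂𝔇.μG) ∧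
        𝔇.PacketCharHRegularity ∧ 𝔇.UpRegularity ∧ 𝔇.ellG ⊆ 𝔇.regG ∧
        (∀ π : IrrClass (Gqs L v), 𝔇.IsEllipticRep π → ∀ T ∈ 𝔇.cartanG, MemLp (fun t : ↥T => (𝔇.DG (t : Gqs L v) : ℂ) * 𝔇.char π (t : Gqs L v)) 2 (𝔇.μT T)) ∧ 𝔇.L2UpOnTorus ∧
        𝔇.DetNotL2 ∧ 𝔇.PiNNotL2 ∧ 𝔇.PacketCharHNorm ∧ (∀ ρ ∈ 𝔇.sqPacketsH, 𝔇.InnerHDefined (𝔇.packetCharH ρ) (𝔇.packetCharH ρ)) ∧ 𝔇.LdsNotL2 ∧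
        𝔇.EllCartanSubset ∧ 𝔇.EllCartanAE ∧ 𝔇.NonEllCartanAE ∧ 𝔇.LdsCardTwo ∧
        𝔇.LdsPseudoCoeffTraceH ({πSt} : Finset (IrrClass (((UnitaryGroup.cmDatum L 2 (Matrix.of fun i j : Fin 2 => if i.val + j.val + 1 = 2 then (1 : L) else 0)).Local v × (UnitaryGroup.cmDatum L 1 (Matrix.of fun i j : Fin 1 => if i.val + j.val + 1 = 1 then (1 : L) else 0)).Local v)))) ∧
        (∀ ψ' : ↥(Subgroup.center (Gqs L v)) →* ℂˣ, Continuous ψ' → 𝔇.IsL2 (𝔇.stG ψ')) ∧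
        (∀ ξ' : ((UnitaryGroup.cmDatum L 2 (Matrix.of fun i j : Fin 2 => if i.val + j.val + 1 = 2 then (1 : L) else 0)).Local v × (UnitaryGroup.cmDatum L 1 (Matrix.of fun i j : Fin 1 => if i.val + j.val + 1 = 1 then (1 : L) else 0)).Local v) →* ℂˣ, Continuous ξ' → 𝔇.IsL2 (𝔇.pi2 ξ')) ∧
        (∀ π ∈ 𝔇.irredPS, ¬ 𝔇.IsL2 π → ∀ f : Gqs L v → ℂ, IsLocSmooth f → π.smoothTrace νQv f = Representation.smoothTrace (G := Gqs L v) (UnitaryGroup.cmPrincipalSeries L 3 v (UnitaryGroup.cmTorusCharPair L v (par π).1 (par π).2)) νQv f) ∧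
        (∀ π σ : IrrClass (Gqs L v), ¬ 𝔇.IsL2 π → 𝔇.IsL2 σ → 𝔇.IsEllipticPair π σ → ∀ f : Gqs L v → ℂ, IsLocSmooth f →
            π.smoothTrace νQv f + σ.smoothTrace νQv f = Representation.smoothTrace (G := Gqs L v) (UnitaryGroup.cmPrincipalSeries L 3 v (UnitaryGroup.cmTorusCharPair L v (par π).1 (par π).2)) νQv f) ∧
        (∀ P ∈ 𝔇.ldsPackets, ∀ π' ∈ P, ∀ π'' ∈ P, π' ≠ π'' → par π'' = par π' ∧ ∀ f : Gqs L v → ℂ, IsLocSmooth f →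
            π'.smoothTrace νQv f + π''.smoothTrace νQv f = Representation.smoothTrace (G := Gqs L v) (UnitaryGroup.cmPrincipalSeries L 3 v (UnitaryGroup.cmTorusCharPair L v (par π').1 (par π').2)) νQv f) ∧
        (∀ π : IrrClass (Gqs L v), ¬ 𝔇.IsL2 π →
            π.IsConstituentOf (UnitaryGroup.cmPrincipalSeries L 3 v (UnitaryGroup.cmTorusCharPair L v (par π).1 (par π).2)) ∧
              Continuous (par π).1 ∧ Continuous (par π).2) ∧
        (∀ u u' : IrrClass (Gqs L v), ¬ 𝔇.IsL2 u → ¬ 𝔇.IsL2 u' →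
            (par u' = par u ∨ par u' = (conjInvChar (conjLocal L (IsCMField.complexConj L) v) (par u).1, (par u).2)) →
            u' = u ∨ ∃ P ∈ 𝔇.ldsPackets, u ∈ P ∧ u' ∈ P) ∧
        (∀ (π : IrrClass (Gqs L v)) (f : Gqs L v → ℂ), 𝔇.IsL2 π → 𝔇.IsPseudoCoeff π f → f 1 = (d π : ℂ)) ∧
        (∀ π : IrrClass (Gqs L v), 𝔇.IsL2 π → 0 < d π) ∧
        (∀ γ ∈ T, γ ∈ 𝔇.regG → γ ∈ 𝔇.ellG ∧
            ∀ z : (UnitaryGroup.cmDatum L 1 (Matrix.of fun i j : Fin 1 => if i.val + j.val + 1 = 1 then (1 : L) else 0)).Local v,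
              ¬ ((γ.val.val : Matrix (Fin 3) (Fin 3) (UnitaryGroup.LocalRing L v)).charpoly).IsRoot
                (((z.val.val : Matrix (Fin 1) (Fin 1) (UnitaryGroup.LocalRing L v))) 0 0)) ∧
        (∃ c : ℝ, c ≠ 0 ∧ ∀ f : Gqs L v → ℂ, IsLocSmooth f → ∃ α : Gqs L v → ℂ,
            (∀ᶠ γ in 𝓝[((T : Set (Gqs L v)) ∩ 𝔇.regG)] (1 : Gqs L v), 𝔇.orbInt γ f = (c : ℂ) * f 1 + α γ) ∧
            ∀ κ : ℂ, (∀ᶠ γ in 𝓝[((T : Set (Gqs L v)) ∩ 𝔇.regG)] (1 : Gqs L v), α γ = κ) → κ = 0) ∧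
        (∀ t : ↥(cmBorelTriple L 3 v).M, IsRegularElt ((((t : ↥(unitaryGroupOfForm (conjLocal L (IsCMField.complexConj L) v) (cmLocalForm L 3 v))) : Gqs L v).val : GL (Fin 3) (UnitaryGroup.LocalRing L v))) → ((t : ↥(unitaryGroupOfForm (conjLocal L (IsCMField.complexConj L) v) (cmLocalForm L 3 v))) : Gqs L v) ∉ 𝔇.ellG) ∧
        normalizedCharacter_locallyBounded ∧
          (∃ B : ℝ, ∀ m : ((LocalRing L v)ˣ × ↥(normOneUnits (conjLocal L (IsCMField.complexConj L) v))), m ∈ (((Submonoid.pi Set.univ (fun w : PlacesOver L v => (w.1.adicCompletionIntegers L).toSubring.toSubmonoid)).units.prod (⊤ : Subgroup ↥(normOneUnits (conjLocal L (IsCMField.complexConj L) v)))) : Subgroup ((LocalRing L v)ˣ × ↥(normOneUnits (conjLocal L (IsCMField.complexConj L) v)))) →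
            ‖(((vanDijkWeight L v (torusChart L v m)).re : ℝ) : ℂ) * 𝔇.up (𝔇.packetCharH {πSt}) (((torusChart L v m : ↥(cmBorelTriple L 3 v).M) : ↥(unitaryGroupOfForm (conjLocal L (IsCMField.complexConj L) v) (cmLocalForm L 3 v))) : Gqs L v)‖ ≤ B) := by
  intro L _ _ _ μ ξ v hns hμu hμω _ _ _ _ νHv νQv _ _ _ _ mHv mQv hcanH hcanQ hT_v π₁ πSt hlab hπ₁ _ _ μZ _ 𝔇 d T par μv
    hC01 hC02 hC03 hC04 hC05 hC06 hC07 hE hchar hAll hHaar hcart hHaarG hfinG hker eDG eDH hKH hFH hHBH hNL hPSpar hLdsF hW hμq hμc hStH hRegH hUp hHBHP hGerm hlabels hSt hStJH hKeysJH hM1lc hcovA hncA hcptA hinvT hcoreT hIrr hKeys hT3 hDet hKeysRed hLdsTwo hDGli h1252 hPCEnsNW hL2oneNsNW h61bNs hLdsOne hM1H hM5 hR0 hStL2 hPL hdpos hHCB eIrr eSt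
  letI : ∀ a : ((UnitaryGroup.cmDatum L 2 (Matrix.of fun i j : Fin 2 => if i.val + j.val + 1 = 2 then (1 : L) else 0)).Local v × (UnitaryGroup.cmDatum L 1 (Matrix.of fun i j : Fin 1 => if i.val + j.val + 1 = 1 then (1 : L) else 0)).Local v), MeasurableSpace (((UnitaryGroup.cmDatum L 2 (Matrix.of fun i j : Fin 2 => if i.val + j.val + 1 = 2 then (1 : L) else 0)).Local v × (UnitaryGroup.cmDatum L 1 (Matrix.of fun i j : Fin 1 => if i.val + j.val + 1 = 1 then (1 : L) else 0)).Local v) ⧸ Subgroup.centralizer ({a} : Set ((UnitaryGroup.cmDatum L 2 (Matrix.of fun i j : Fin 2 => if i.val + j.val + 1 = 2 then (1 : L) else 0)).Local v × (UnitaryGroup.cmDatum L 1 (Matrix.of fun i j : Fin 1 => if i.val + j.val + 1 = 1 then (1 : L) else 0)).Local v))) := fun _ => borel _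
  haveI : ∀ a : ((UnitaryGroup.cmDatum L 2 (Matrix.of fun i j : Fin 2 => if i.val + j.val + 1 = 2 then (1 : L) else 0)).Local v × (UnitaryGroup.cmDatum L 1 (Matrix.of fun i j : Fin 1 => if i.val + j.val + 1 = 1 then (1 : L) else 0)).Local v), BorelSpace (((UnitaryGroup.cmDatum L 2 (Matrix.of fun i j : Fin 2 => if i.val + j.val + 1 = 2 then (1 : L) else 0)).Local v × (UnitaryGroup.cmDatum L 1 (Matrix.of fun i j : Fin 1 => if i.val + j.val + 1 = 1 then (1 : L) else 0)).Local v) ⧸ Subgroup.centralizer ({a} : Set ((UnitaryGroup.cmDatum L 2 (Matrix.of fun i j : Fin 2 => if i.val + j.val + 1 = 2 then (1 : L) else 0)).Local v × (UnitaryGroup.cmDatum L 1 (Matrix.of fun i j : Fin 1 => if i.val + j.val + 1 = 1 then (1 : L) else 0)).Local v))) := fun _ => ⟨rfl⟩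
  letI : ∀ γ : Gqs L v, MeasurableSpace (Gqs L v ⧸ Subgroup.centralizer ({γ} : Set (Gqs L v))) := fun _ => borel _
  haveI : ∀ γ : Gqs L v, BorelSpace (Gqs L v ⧸ Subgroup.centralizer ({γ} : Set (Gqs L v))) := fun _ => ⟨rfl⟩
  -- ★ DG-FIELD ∕ DG-LC: the `D_G` clauses from the closed formula `eDG`
  have hDGm : Measurable 𝔇.DG := F0P3cStCharTSDGField.measurable_DG L v 𝔇 eDG
  have hDG := F0P3cStCharTSDGField.DG_eq_zero_or_le L v 𝔇 eDG
  have hD5 := F0P3cStCharTSDGField.DG_coe_torus_eq_of_unit_rel L v 𝔇 eDG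
  have hDGlc := F0P3cStCharTSDGLc.DG_eventually_eq_of_mem_regG L v 𝔇 hC05 eDG
  -- ★ DG-FIELD-TWO ∕ DH-STABLE ∕ DH-LC: the `D_H` clauses from the closed formula `eDH`
  have h20 := F0P3cStCharTSDGFieldTwo.dgFormulaTwo_eq_zero_of_not_isUnit_discr L v (Matrix.of fun i j : Fin 2 => if i.val + j.val + 1 = 2 then (1 : L) else 0)
  have h2u := F0P3cStCharTSDGFieldTwo.dgFormulaTwo_eq_of_unit_rel L v (Matrix.of fun i j : Fin 2 => if i.val + j.val + 1 = 2 then (1 : L) else 0)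
  have hDHm : Measurable 𝔇.DH := by
    rw [show 𝔇.DH = _ from funext eDH]
    letI : MeasurableSpace ((UnitaryGroup.cmDatum L 2 (Matrix.of fun i j : Fin 2 => if i.val + j.val + 1 = 2 then (1 : L) else 0)).Local v) := borel _
    haveI : BorelSpace ((UnitaryGroup.cmDatum L 2 (Matrix.of fun i j : Fin 2 => if i.val + j.val + 1 = 2 then (1 : L) else 0)).Local v) := ⟨rfl⟩
    exact (F0P3cStCharTSDGFieldTwo.continuous_dgFormulaTwo L v (Matrix.of fun i j : Fin 2 => if i.val + j.val + 1 = 2 then (1 : L) else 0)).measurable.comp continuous_fst.measurable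
  have hDHst := F0P3cStCharTSDHStable.hDHst_of_pin L v 𝔇 (fun g : ((UnitaryGroup.cmDatum L 2 (Matrix.of fun i j : Fin 2 => if i.val + j.val + 1 = 2 then (1 : L) else 0)).Local v) => ((NNReal.sqrt (NNReal.sqrt ((∏ w : PlacesOver L v, IsNonarchimedeanLocalField.normAbs (w.1.adicCompletion L) (((g.val : GL (Fin 2) (UnitaryGroup.LocalRing L v)).val.charpoly.discr) w)) * (∏ w : PlacesOver L v, IsNonarchimedeanLocalField.normAbs (w.1.adicCompletion L) (((g.val : GL (Fin 2) (UnitaryGroup.LocalRing L v)).val.det) w))⁻¹)) : ℝ≥0) : ℝ)) h20 h2u eDH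
  have hDHlc := F0P3cStCharTSDHLc.hDHlc_of_pin L v 𝔇 (fun g : ((UnitaryGroup.cmDatum L 2 (Matrix.of fun i j : Fin 2 => if i.val + j.val + 1 = 2 then (1 : L) else 0)).Local v) => ((NNReal.sqrt (NNReal.sqrt ((∏ w : PlacesOver L v, IsNonarchimedeanLocalField.normAbs (w.1.adicCompletion L) (((g.val : GL (Fin 2) (UnitaryGroup.LocalRing L v)).val.charpoly.discr) w)) * (∏ w : PlacesOver L v, IsNonarchimedeanLocalField.normAbs (w.1.adicCompletion L) (((g.val : GL (Fin 2) (UnitaryGroup.LocalRing L v)).val.det) w))⁻¹)) : ℝ≥0) : ℝ)) h20 h2u eDH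
  -- ★ DG-FIELD-REG ∕ UP-MEAS ∕ UP-CLASS ∕ UP-TR PLUG: `UpSpecLB` = measurability + class-function property (in-house) + the LOCALLY-BOUNDED transfer display `hUpTrLB` (★ plug p852447)
  have hDGcl := F0P3cStCharTSDGFieldReg.DG_conj L v 𝔇 eDG
  have hUpTrLB : (∀ α : ((UnitaryGroup.cmDatum L 2 (Matrix.of fun i j : Fin 2 => if i.val + j.val + 1 = 2 then (1 : L) else 0)).Local v × (UnitaryGroup.cmDatum L 1 (Matrix.of fun i j : Fin 1 => if i.val + j.val + 1 = 1 then (1 : L) else 0)).Local v) → ℂ, Measurable α → Ch12Sec5.IsStableClassFunOn 𝔇.stConjH 𝔇.regH α → (∀ C : Set ((UnitaryGroup.cmDatum L 2 (Matrix.of fun i j : Fin 2 => if i.val + j.val + 1 = 2 then (1 : L) else 0)).Local v × (UnitaryGroup.cmDatum L 1 (Matrix.of fun i j : Fin 1 => if i.val + j.val + 1 = 1 then (1 : L) else 0)).Local v), IsCompact C → ∃ B : ℝ, ∀ s ∈ C, s ∈ 𝔇.regH → ‖(𝔇.DH s : ℂ) * α s‖ ≤ B) → ∀ f ∈ SchwartzBruhat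 (Gqs L v), ∀ fH : ((UnitaryGroup.cmDatum L 2 (Matrix.of fun i j : Fin 2 => if i.val + j.val + 1 = 2 then (1 : L) else 0)).Local v × (UnitaryGroup.cmDatum L 1 (Matrix.of fun i j : Fin 1 => if i.val + j.val + 1 = 1 then (1 : L) else 0)).Local v) → ℂ, 𝔇.IsTransfer f fH → Integrable (fun g => f g * 𝔇.up α g) 𝔇.μG → Integrable (fun h => fH h * α h) 𝔇.μH → ∫ g, f g * 𝔇.up α g ∂𝔇.μG = ∫ h, fH h * α h ∂𝔇.μH) := F0P3cStCharTSUpTrDatumDict.upTransferLB_of_concrete L v μ νHv νQv mHv mQv 𝔇 hC01 hC02 hC06 eDG eDH hStH hRegH hUp (F0P3cStCharTSUpTrAssembly.upTransferLB_concrete L v hns νHv νQv mHv mQv hcanH hcanQ μ hμu)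
  have hUpSpecLB : 𝔇.UpSpecLB := F0P3cStCharTSUpTrSpecLB.upSpecLB_of_upTransferLB L v μ hns 𝔇 hStH hRegH hDHst hDGm hDHm hDGcl hUp hUpTrLB
  -- ★ WIF-AT-THE-DATUM: the Weyl integration formula from the Cartan pins; the compact-Cartan tube-Jacobian socket by ★ JAC-ELL C8 `tubeJacobianSocket_compactCartan`, the M-socket ★ JAC-LOC inside the head
  have hShapeA : ∀ T' ∈ 𝔇.cartanAll, ∃ γ₀ : Gqs L v, IsRegularElt (γ₀.val : GL (Fin 3) (UnitaryGroup.LocalRing L v)) ∧ T' = Subgroup.centralizer ({γ₀} : Set (Gqs L v)) := fun T' hT' => by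
    rcases (hAll T').1 hT' with h | h
    · subst h; obtain ⟨m₀, -, hreg, hZ⟩ := F0P3cStCharTSCartanReps.exists_isRegularElt_centralizer_eq_cmTorus L v hns; exact ⟨m₀, hreg, hZ.symm⟩
    · exact (hcart T' h).2
  have hHaarT : ∀ T' ∈ 𝔇.cartanAll, (𝔇.μT T').IsHaarMeasure := fun T' hT' => by
    rcases (hAll T').1 hT' with h | h
    · subst h; exact hHaar
    · exact hHaarG T' h
  have hWIF : 𝔇.WeylIntegrationFormula := F0P3cStCharTSWeylDatumPinsWIF.weylIntegrationFormula_of_datumPins L v hns νQv mQv 𝔇 hC01 hC04 hcanQ hC05 hShapeA hcovA hncA hcptA hHaarT hinvT hcoreT eDG (F0P3cStCharTSJacCartanTerminus.tubeJacobianSocket_compactCartan L v hns νQv)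
  -- ★ PS2-KIND2-DATUM: the kind-2 trace identity from the Steinberg field clause `hSt`
  have hK2 := F0P3cStCharTSPs2Kind2Datum.ps2_kind2_of_fields hns μZ 𝔇 hC03 hSt par hNL νQv
  -- ★ UNIQ-PAR: (UNIQ-PAR) from Keys' reducibility list `hKeysRed`
  have hUNIQ := F0P3cStCharTSUniqPar.uniqPar_of_fields hns μZ 𝔇 hC03 hLdsF par hNL hKeysRed
  -- ★ UPR-LI: (UPR) from (UP-DEF), the `D_H`∕`D_G` regularity just derived, (M1H)'s stability clause, `hM1lc`, `hHBHP` and (HC-D) `hDGli`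
  have hUPR : 𝔇.UpRegularity := F0P3cStCharTSUprLi.upRegularity_of_upDef L v μ hμu hns 𝔇 hC05 hStH hRegH hDHst hDHlc hDGlc hUp (fun ρ hρ => (hM1H ρ hρ).2.2.1) hM1lc hHBHP hDGli
  -- ══ v10 «SC-SPLIT»: the SUPERCUSPIDAL instances of K1 ∕ K2′ ∕ K3 are THEOREMS (★ E2 «HC-SC» end to end, F0P3a-p02 (g26) E2-5b p852902: compact induction + Schur orthogonality) ══
  have hC2cert : 𝔇.EllCartanAE :=
    F0P3cStCharTSCartanFields.ellCartanAE_of_compact_centralizers L v 𝔇 hE hcart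
      (F0P3cStCharTSCartanNull.cartanNull_of_rootKernels L v 𝔇 hHaarG (fun T hT => (hcart T hT).1) hker)
  have hC1cert : 𝔇.EllCartanSubset := fun T hT => (hAll T).2 (Or.inr hT)
  have hC3cert : 𝔇.NonEllCartanAE :=
    F0P3cStCharTSCartanFields.nonEllCartanAE_of_split L v 𝔇 hC05 hE (fun T hT hTn => ((hAll T).1 hT).resolve_right hTn) hHaar
  have hL2allcert : 𝔇.L2CharOnTorusAll :=
    F0P3cStCharTSL2dEll.l2CharOnTorusAll_of_elliptic 𝔇 hC2cert
      (F0P3cStCharTSL2dOfHcb.l2dEll_of_hcBounded L v hHCB νQv 𝔇 hC01 hC05 hchar hDGm (fun T hT => (hcart T hT).1) hfinG hDG)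
  -- ══ v9 «NORMS RE-LETTER»: K2′∕K4′ ↦ Prop. 12.6.1 (a)(c) (F0P2-p02 (g23) CERT v2 026d1a8eba6e8e2c) — `hC2cert` above ══
  have hLOcert : Ch12Sec6.LdsCharactersOpposite 𝔇 :=
    F0P3cStCharTSLdsOpp.ldsCharactersOpposite_of_PS3 L v hns νQv mQv hcanQ 𝔇 hC01 hC05 (fun γ hγ => (hE γ).1 hγ)
      (F0P3cStCharTSEllOpen.isOpen_setOf_isRegularElt_and_not_mem_hyperbolicSet L v hns) hchar
      (F0P3cStCharTSLdsFields.lds_sockets_of_ldsFields hns μZ 𝔇 hC03 hLdsF).1 par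
      (F0P3cStCharTSPs3Lds.ps3_of_ldsFields' hns μZ 𝔇 hLdsF par hNL hW νQv)
      (F0P3cStCharTSParField.parField_sockets 𝔇 μZ νQv par hNL hPSpar hIrr hC03).2
  have hPS2cert := F0P3cStCharTSPs2Assembly.ps2_of_kinds hns μv hμq hμc μZ 𝔇 hC03
      (F0P3cStCharTSLdsFields.lds_sockets_of_ldsFields hns μZ 𝔇 hC03 hLdsF).1 hStL2 hKeys hlabels par hNL νQv hK2
  have hOppcert := F0P3cStCharTSOpp23.charOpposite_of_PS2 L v hns νQv mQv hcanQ 𝔇 hC01 hC05 (fun γ hγ => (hE γ).1 hγ)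
      (F0P3cStCharTSEllOpen.isOpen_setOf_isRegularElt_and_not_mem_hyperbolicSet L v hns) hchar par hPS2cert
      (F0P3cStCharTSParField.parField_sockets 𝔇 μZ νQv par hNL hPSpar hIrr hC03).2
  have hKFcert := F0P3cStCharTSXiDict.keysFields_sockets 𝔇 𝔇.μGZ hKeys rfl rfl rfl
  have hScL2cert : ∀ π : IrrClass (Gqs L v), π.IsSupercuspidal → 𝔇.IsL2 π := by
    intro π hsc
    show IrrClass.IsSquareIntegrable 𝔇.μGZ π
    rw [hC03]
    exact IrrClass.isSquareIntegrable_of_isSupercuspidal_of_isCompact_center μZ (F0P3cStCharTSParField.isCompact_center_Gqs L v hns) π hsc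
  have hECcert : Ch12Sec6.EllipticClassification 𝔇 :=
    F0P3cStCharTSRedJH.ellipticClassification_of_keysRed L v hns 𝔇 μv hμq hμc
      (F0P3cStCharTSPsVanish.char_eq_zero_on_ellG_of_isConstituentOf_irreducible L v hns νQv mQv hcanQ 𝔇 hC01 hC05 (fun γ hγ => (hE γ).1 hγ) hchar)
      (F0P3cStCharTSLdsFields.lds_sockets_of_ldsFields hns μZ 𝔇 hC03 hLdsF).2 hKeysRed hStJH hKeysJH hLdsF hLdsTwo
  -- ══ v12 «EP-SPLIT, NOT-WILD» (LEAD T15-11∕T15-13∕T15-17∕T15-20; G column ★ at every NON-WILD place: ★ `exists_epFunction_G_of_not_wild` p853093 over (G3) p853021 + (G3)-RAM, (G4) mass p852975∕p853003, (G5) p852994∕p853007): the `St_G(ψ)`∕`ψ∘det` instances of K1∕K2′ are THEOREMS at unramified v ══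
  have hOppPair : ∀ ψ : ↥(Subgroup.center (Gqs L v)) →* ℂˣ, Continuous ψ → ∀ γ ∈ 𝔇.ellG, 𝔇.char (𝔇.stG ψ) γ = -𝔇.char (𝔇.detG ψ) γ := fun ψ hψ => by
    obtain ⟨ιZ, detZ, -, -, -, -, hStAll⟩ := eSt
    obtain ⟨-, -, -, -, hdetL2μ⟩ := hStAll ψ hψ
    have hndet : ¬ 𝔇.IsL2 (𝔇.detG ψ) := by
      show ¬ IrrClass.IsSquareIntegrable 𝔇.μGZ (𝔇.detG ψ)
      rw [hC03]; exact hdetL2μ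
    exact hOppcert (𝔇.detG ψ) (𝔇.stG ψ) hndet (hStL2 ψ hψ) (Or.inr (Or.inl ⟨ψ, hψ, Or.inr ⟨rfl, rfl⟩⟩))
  have hPCE : Ch12Sec6.PseudoCoeffExists 𝔇 := fun π hπ => by
    by_cases hsc : π.IsSupercuspidal
    · obtain ⟨f, hf, -⟩ := F0P3cStCharTSScPseudoCoeff.exists_isPseudoCoeff_of_isSupercuspidal L v hns νQv mQv hcanQ 𝔇 hC01 hC04 hC05 hE hchar π hsc
      exact ⟨f, hf⟩
    · by_cases hep : (Algebra.IsUnramifiedIn (𝓞 L) v.asIdeal ∨ Valued.v (2 : v.adicCompletion ↥(maximalRealSubfield L)) = 1) ∧ ∃ ψ : ↥(Subgroup.center (Gqs L v)) →* ℂˣ, Continuous ψ ∧ (π = 𝔇.stG ψ ∨ π = 𝔇.detG ψ)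
      · obtain ⟨hunr, ψ, hψ, hπψ⟩ := hep
        obtain ⟨ιZ, detZ, -, -, -, -, hStAll⟩ := eSt
        obtain ⟨⟨hopen, hdet⟩, -, -, -, -⟩ := hStAll ψ hψ
        have hEP := F0P3cStCharTSEPGlueGNotWild.exists_epFunction_G_of_not_wild L v hns hunr νQv hcanQ
        rcases hπψ with rfl | rfl
        · obtain ⟨f, hf, -, -⟩ := F0P3cStCharTSEPPseudoCoeffStLetters.exists_isPseudoCoeff_stG_of_epFunction L v hns νQv mQv 𝔇 hC01 hC04 hC05 hE hchar hEP ψ detZ hopen hdet (hOppPair ψ hψ)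
          exact ⟨f, hf⟩
        · exact F0P3cStCharTSEPPseudoCoeffStLetters.exists_isPseudoCoeff_detG_of_epFunction L v hns νQv mQv 𝔇 hC01 hC04 hC05 hE hchar hEP ψ detZ hopen hdet
      · exact hPCEnsNW π hπ hsc hep
  have hL2one : ∀ σ : IrrClass (Gqs L v), 𝔇.IsL2 σ → 𝔇.innerG (𝔇.char σ) (𝔇.char σ) = 1 := fun σ hσ => by
    by_cases hsc : σ.IsSupercuspidal
    · exact F0P3cStCharTSScPseudoCoeff.innerG_char_self_eq_one_of_isSupercuspidal L v hns νQv mQv hcanQ 𝔇 hC01 hC04 hC05 hE hchar hWIF hC1cert hC2cert hC3cert hL2allcert σ hsc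
    · by_cases hep : (Algebra.IsUnramifiedIn (𝓞 L) v.asIdeal ∨ Valued.v (2 : v.adicCompletion ↥(maximalRealSubfield L)) = 1) ∧ ∃ ψ : ↥(Subgroup.center (Gqs L v)) →* ℂˣ, Continuous ψ ∧ σ = 𝔇.stG ψ
      · obtain ⟨hunr, ψ, hψ, rfl⟩ := hep
        obtain ⟨ιZ, detZ, -, -, -, -, hStAll⟩ := eSt
        obtain ⟨⟨hopen, hdet⟩, -, -, -, -⟩ := hStAll ψ hψ
        obtain ⟨fG, hfs, hfm, hfi, hf1, hfim, hfre, hfE, hfN⟩ := F0P3cStCharTSEPGlueGNotWild.exists_epFunction_G_of_not_wild L v hns hunr νQv hcanQ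
        have hMass := F0P3cStCharTSEllMassG.ellipticWeylMass_G_eq_one_of_epFunction_of_l2CharOnTorusAll L v hns νQv hcanQ 𝔇 hC01 hC04 hC05 hE hchar hWIF hC1cert hC2cert hC3cert hL2allcert fG hfs hfm hfi hf1 hfim hfre hfE hfN
        exact F0P3cStCharTSEPPseudoCoeffStLetters.innerG_char_stG_self_eq_one_of_mass L v hns νQv 𝔇 hC01 hC05 hE hchar hC2cert hMass hψ detZ hopen hdet (hOppPair ψ hψ)
      · exact hL2oneNsNW σ hσ hsc hep
  have h61b : Ch12Sec6.Prop1261b 𝔇 := fun π π' hπ hπ' hne0 hne => by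
    by_cases hsc' : π'.IsSupercuspidal
    · exact absurd (F0P3cStCharTSScPseudoCoeff.innerG_char_eq_zero_of_ne_of_isSupercuspidal L v hns νQv mQv hcanQ 𝔇 hC01 hC04 hC05 hE hchar hWIF hC1cert hC2cert hC3cert hL2allcert π π' hsc' hne) hne0
    · by_cases hsc : π.IsSupercuspidal
      · have h0 := F0P3cStCharTSScPseudoCoeff.innerG_char_eq_zero_of_ne_of_isSupercuspidal L v hns νQv mQv hcanQ 𝔇 hC01 hC04 hC05 hE hchar hWIF hC1cert hC2cert hC3cert hL2allcert π' π hsc (Ne.symm hne)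
        have h0' : 𝔇.innerG (𝔇.char π) (𝔇.char π') = 0 := by
          rw [F0P3cStCharTSScFin.innerG_conj_symm 𝔇 (𝔇.char π') (𝔇.char π), h0, map_zero]
        exact absurd h0' hne0
      · exact h61bNs π π' hπ hπ' hsc hsc' hne0 hne
  have h61a : Ch12Sec6.Prop1261a 𝔇 :=
    F0P3cStCharTSProp1261aOfNorms.prop1261a_of_norms 𝔇 hC2cert hECcert hScL2cert hOppcert hL2one hLdsOne hStL2 hKFcert.2
  have h61c : Ch12Sec6.Prop1261c 𝔇 :=
    F0P3cStCharTSProp1261cOfNorms.prop1261c_of_prop1261a 𝔇 hC2cert hLOcert hOppcert h61a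
      (F0P3cStCharTSEllOut.ellipticOfL2_of_PL 𝔇 d hPL hdpos) hLdsOne hStL2 hDet hKFcert.2 hKFcert.1
  -- ══ v9 «EONPS FOLD»: «elliptic ⟸ not a PS constituent» [§12.6 p. 187] from Prop. 12.6.1 (c) + the §12.2 JH list + (SC-L2)(ST-L2)(PI2-L2)(ELL)(C2) (★ EONPS-OUT, F0P3a-p05 (g25)) ══
  have hEllNotPS : Ch12Sec6.EllipticOfNotPrincipalSeries 𝔇 :=
    F0P3cStCharTSEonpsOut.ellipticOfNotPrincipalSeries_of_prop1261c_of_PL L v hns μZ 𝔇 hC03 eIrr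
      (F0P3cStCharTSRedJH.redJH_of_keysRed L v hns 𝔇 μv hμq hμc hKeysRed hStJH hKeysJH hLdsF hLdsTwo)
      (F0P3cStCharTSLdsFields.lds_sockets_of_ldsFields hns μZ 𝔇 hC03 hLdsF).2 hStL2 hKFcert.2 d hPL hdpos h61c hC2cert
  exact ⟨hC01, hC02, hC03, hC04, hC05, hC06, hC07, hWIF, hUpSpecLB, h1252, hPCE, h61a, h61b, h61c, (F0P3cStCharTSLdsOpp.ldsCharactersOpposite_of_PS3 L v hns νQv mQv hcanQ 𝔇 hC01 hC05 (fun γ hγ => (hE γ).1 hγ) (F0P3cStCharTSEllOpen.isOpen_setOf_isRegularElt_and_not_mem_hyperbolicSet L v hns) hchar (F0P3cStCharTSLdsFields.lds_sockets_of_ldsFields hns μZ 𝔇 hC03 hLdsF).1 par (F0P3cStCharTSPs3Lds.ps3_of_ldsFields' hns μZ 𝔇 hLdsF par hNL hW νQv) (F0P3cStCharTSParField.parField_sockets 𝔇 μZ νQv par hNL hPSpar hIrr hC03).2), hEllNotPS, (F0P3cStCharTSRedJH.ellipticClassification_of_keysRed L v hns 𝔇 μv hμq hμc (F0P3cStCharTSPsVanish.char_eq_zero_on_ellG_of_isConstituentOf_irreducible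 L v hns νQv mQv hcanQ 𝔇 hC01 hC05 (fun γ hγ => (hE γ).1 hγ) hchar) (F0P3cStCharTSLdsFields.lds_sockets_of_ldsFields hns μZ 𝔇 hC03 hLdsF).2 hKeysRed hStJH hKeysJH hLdsF hLdsTwo), hchar, hM1H, hUPR, (F0P3cStCharTSEllField.ellG_subset_regG L v 𝔇 hC05 hE), (F0P3cStCharTSL2dOfHcb.l2dEll_of_hcBounded L v hHCB νQv 𝔇 hC01 hC05 hchar hDGm (fun T hT => (hcart T hT).1) hfinG hDG), (F0P3cStCharTSU2OfUpDom.l2UpOnTorus_of_upDom_LB 𝔇 (IsLocalGRegular L v) 3 hUpSpecLB hM1H hDGm (fun T hT => (hcart T hT).1) hfinG (F0P3cStCharTSUpDom.upDom_of_upDef L v μ hμu hns 𝔇 hC05 hStH hRegH hDHst hUp) hHBHP), hDet, (F0P3cStCharTSXiDict.keysFields_sockets 𝔇 𝔇.μGZ hKeys rfl rfl rfl).1, hM5, (F0P3cStCharTSDefHGlue.defH_of_hcBoundedH 𝔇 hM1H hDHm hKH hFH hHBH), (F0P3cStCharTSLdsFields.lds_sockets_of_ldsFields hns μZ 𝔇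 hC03 hLdsF).1, (fun T hT => (hAll T).2 (Or.inr hT)), (F0P3cStCharTSCartanFields.ellCartanAE_of_compact_centralizers L v 𝔇 hE hcart (F0P3cStCharTSCartanNull.cartanNull_of_rootKernels L v 𝔇 hHaarG (fun T hT => (hcart T hT).1) hker)), (F0P3cStCharTSCartanFields.nonEllCartanAE_of_split L v 𝔇 hC05 hE (fun T hT hTn => ((hAll T).1 hT).resolve_right hTn) hHaar), (F0P3cStCharTSLdsFields.lds_sockets_of_ldsFields hns μZ 𝔇 hC03 hLdsF).2, hR0, hStL2, (F0P3cStCharTSXiDict.keysFields_sockets 𝔇 𝔇.μGZ hKeys rfl rfl rfl).2, (F0P3cStCharTSParField.parField_sockets 𝔇 μZ νQv par hNL hPSpar hIrr hC03).1, (F0P3cStCharTSPs2Assembly.ps2_of_kinds hns μv hμq hμc μZ 𝔇 hC03 (F0P3cStCharTSLdsFields.lds_sockets_of_ldsFields hns μZ 𝔇 hC03 hLdsF).1 hStL2 hKeys hlabels par hNL νQv hK2), (F0P3cStCharTSPs3Lds.ps3_of_ldsFields' hns μZ 𝔇 hLdsF par hNL hW νQv), (F0P3cStCharTSParField.parField_sockets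 𝔇 μZ νQv par hNL hPSpar hIrr hC03).2, hUNIQ, hPL, hdpos, (fun γ hγ hreg => ⟨(hE γ).2 ⟨(hC05 γ).1 hreg, F0P3cStCharTSEllField.not_mem_hyperbolicSet_of_forall_not_isRoot L v (hT3 γ hγ ((hC05 γ).1 hreg))⟩, fun z => hT3 γ hγ ((hC05 γ).1 hreg) _⟩), (F0P3cStCharTSGermThree.germThree_local_of_germResidue L (qsForm L) v mQv 𝔇 hC04 hC05 T hGerm), (F0P3cStCharTSEllField.splitNotEll L v 𝔇 hE), hHCB, (F0P3cStCharTSU2OfUpDom.hcbUp_of_upDom L v hns 𝔇 (IsLocalGRegular L v) 3 hM1H (F0P3cStCharTSUpDom.upDom_of_upDef L v μ hμu hns 𝔇 hC05 hStH hRegH hDHst hUp) hHBHP πSt hC07 hD5)⟩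

end Summit.HodgeConjecture.HodgeConjecture.Cruxes.H413.F0P3cStCharTSDatumJunction12

end
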